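import Summits.Ventures.HSemireg.WedgeHankelBoxFaces
import Summits.Ventures.HSemireg.WedgeHankelBoxSiegel

/-!
# Venture HSemireg — for the box of MIDDLE POWERS `Θ_i^{⌊m_i/2⌋}` with all `m_i ≥ 4` the degree-2 kernel IS the product Siegel space:
# `ker(θ ↦ θ ∧ F ∣ ⋀²) = ⊕_i emb_i(Siegel_{m_i})`, uniform in the number of factors

HONEST FRAMING. Part of the Lean index of the computation cell `pub-hsemireg` (seat p10 gen 10, Sunday typer «UNIFORM-IN-n»).  Exterior
algebra over a field and binomial arithmetic ONLY; no variety, sheaf, Ext group or semiregularity map; nothing here says that HC / HC_CM / HC_AV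
holds; no Literature fact.  Custodian versions cited: theory/FORMULA-N.md PART A §2.6 THEOREM H / FN-4 (i) («ρ = 3 generic: 3C(n,2) on HT²»,
«v-independent kernel the Θ-isotropic part»); STRUCTURE.md v1.0-SIGNED 9b196a05977dd067 §1.1 C15.  Dictionary QUOTED, never asserted.

This file COMPOSES `WedgeHankelBoxFaces` §6 (the box of middle powers ATTAINS the box ceiling: `rank = [t²] Π_i G_{m_i}`) with `WedgeHankelBoxSiegel`
§4 (`SiegelBox ≤ ker`, `2·dim SiegelBox = Σ_i m_i(m_i+1)`):
* §1 coefficient bookkeeping: for polynomials with constant term `1`, `2·[t²]Π f_i + Σ ([t¹]f_i)² = 2·Σ [t²]f_i + (Σ [t¹]f_i)²` (`two_mul_coeff_two_prod`);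
  the low coefficients of the generic polynomial `G_m = 1 + 2m·t + 3C(m,2)·t² + …` for `m ≥ 4` (`coeff_genericPoly_zero/one/two`).
* §2 **`two_mul_finrank_ker_middle_box`: for all `m_i ≥ 4`, `2·dim ker(θ ↦ θ ∧ F ∣ ⋀²) = Σ_i m_i(m_i+1)` for the box of middle powers** (rank–nullity,
  the attained ceiling and `C(Σ2m_i, 2) − [t²]ΠG_{m_i} = Σ m_i(m_i+1)/2`: the cross terms `4m_im_j` cancel), hence
  **`ker_middle_box_eq_siegelBox`: `ker(θ ↦ θ ∧ F ∣ ⋀²) = SiegelBox`** (as submodules of `⋀²`): for the Hankel-generic box the product of the factors'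
  Siegel spaces is the WHOLE degree-2 kernel — nothing beyond the polarisation-preserving product deformations contracts it to zero.
NOT typed: factors of dimension `≤ 3` (there the generic kernel exceeds the Siegel part); other Hankel-generic boxes (any `q` attaining the ceiling in degree 2
would do — stated for the middle powers only); higher degrees; Ext side.  Class side only.
Namespace `Summit.Ventures.HSemireg.Wedge.HankelBox` (continued); new names only.
-/

open Module Polynomial

namespace Summit.Ventures.HSemireg.Wedge.HankelBox

open Summit.Ventures.HSemireg.Wedge Summit.Ventures.HSemireg.Wedge.Kunneth Summit.Ventures.HSemireg.Wedge.MixedBox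
  Summit.Ventures.HSemireg.Wedge.HankelSiegel Summit.Ventures.HSemireg.Wedge.HankelSpikes

variable (K : Type*) [Field K]

/-! ## §1. Coefficient bookkeeping -/

/-- the three lowest coefficients of a product of two polynomials. -/
lemma coeff_mul_low (f g : Polynomial ℕ) :
    (f * g).coeff 0 = f.coeff 0 * g.coeff 0 ∧ (f * g).coeff 1 = f.coeff 0 * g.coeff 1 + f.coeff 1 * g.coeff 0 ∧
      (f * g).coeff 2 = f.coeff 0 * g.coeff 2 + f.coeff 1 * g.coeff 1 + f.coeff 2 * g.coeff 0 := by
  refine ⟨?_, ?_, ?_⟩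
  · rw [coeff_mul, Finset.Nat.sum_antidiagonal_eq_sum_range_succ (fun i j => f.coeff i * g.coeff j) 0]
    simp
  · rw [coeff_mul, Finset.Nat.sum_antidiagonal_eq_sum_range_succ (fun i j => f.coeff i * g.coeff j) 1]
    simp [Finset.sum_range_succ]
  · rw [coeff_mul, Finset.Nat.sum_antidiagonal_eq_sum_range_succ (fun i j => f.coeff i * g.coeff j) 2]
    simp [Finset.sum_range_succ]

/-- **`[t⁰]`, `[t¹]`, `[t²]` of a finite product of polynomials with constant term `1`**: `[t⁰] = 1`, `[t¹] = Σ [t¹]f_i`, and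
`2·[t²]Π f_i + Σ_i ([t¹]f_i)² = 2·Σ_i [t²]f_i + (Σ_i [t¹]f_i)²`. -/
theorem two_mul_coeff_two_prod {ι : Type*} (s : Finset ι) (f : ι → Polynomial ℕ) (h0 : ∀ i ∈ s, (f i).coeff 0 = 1) :
    (∏ i ∈ s, f i).coeff 0 = 1 ∧ (∏ i ∈ s, f i).coeff 1 = ∑ i ∈ s, (f i).coeff 1 ∧
      2 * (∏ i ∈ s, f i).coeff 2 + ∑ i ∈ s, (f i).coeff 1 ^ 2 = 2 * ∑ i ∈ s, (f i).coeff 2 + (∑ i ∈ s, (f i).coeff 1) ^ 2 := by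
  classical
  induction s using Finset.induction_on with
  | empty => simp [coeff_one]
  | insert a s ha ih =>
    obtain ⟨ih0, ih1, ih2⟩ := ih (fun i hi => h0 i (Finset.mem_insert_of_mem hi))
    have ha0 := h0 a (Finset.mem_insert_self a s)
    obtain ⟨c0, c1, c2⟩ := coeff_mul_low (f a) (∏ i ∈ s, f i)
    rw [Finset.prod_insert ha, Finset.sum_insert ha, Finset.sum_insert ha, Finset.sum_insert ha, c0, c1, c2, ha0, ih0, ih1]
    refine ⟨by ring, by ring, ?_⟩
    nlinarith [ih2]

variable (m : ℕ)

/-- `[t⁰] G_m = 1`. -/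
lemma coeff_genericPoly_zero : (genericPoly m).coeff 0 = 1 := by
  rw [coeff_genericPoly, Nat.choose_zero_right]
  simp

/-- `[t¹] G_m = 2m` for `m ≥ 2`. -/
lemma coeff_genericPoly_one (hm : 2 ≤ m) : (genericPoly m).coeff 1 = 2 * m := by
  rw [coeff_genericPoly, Nat.choose_one_right, min_eq_left (by omega), mul_comm]

/-- `[t²] G_m = 3·C(m,2)` for `m ≥ 4` (th-6's «3C(n,2)»). -/
lemma coeff_genericPoly_two (hm : 4 ≤ m) : (genericPoly m).coeff 2 = 3 * m.choose 2 := by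
  rw [coeff_genericPoly, min_eq_left (by omega), mul_comm]

/-! ## §2. The kernel of the box of middle powers is the product Siegel space -/

section Middle

variable {n : ℕ} (m : Fin n → ℕ)

/-- binomial bookkeeping: `m² = 2·C(m,2) + m`. -/
lemma sq_eq_two_mul_choose_two_add (k : ℕ) : k * k = 2 * k.choose 2 + k := by
  induction k with
  | zero => simp
  | succ k ih =>
    rw [Nat.choose_succ_succ', Nat.choose_one_right]
    nlinarith [ih]

/-- the arithmetic identity behind the cancellation: with `N = Σ 2m_i`, `2·C(N,2) = 2·[t²]Π_i G_{m_i} + Σ_i m_i(m_i+1)` when all `m_i ≥ 4`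
(the cross terms `4 m_i m_j` of `C(N,2)` and of `[t²]ΠG` cancel; per factor `C(2m,2) − 3C(m,2) = m(m+1)/2`). -/
theorem two_mul_choose_two_card_Gen (hm : ∀ i, 4 ≤ m i) :
    2 * (∑ i : Fin n, (m i + m i)).choose 2 = 2 * (∏ i : Fin n, genericPoly (m i)).coeff 2 + ∑ i : Fin n, m i * (m i + 1) := by
  obtain ⟨-, -, h2⟩ := two_mul_coeff_two_prod Finset.univ (fun i => genericPoly (m i)) (fun i _ => coeff_genericPoly_zero (m i))
  have hc1 : ∀ i : Fin n, (genericPoly (m i)).coeff 1 = 2 * m i := fun i => coeff_genericPoly_one (m i) (by have := hm i; omega)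
  have hc2 : ∀ i : Fin n, (genericPoly (m i)).coeff 2 = 3 * (m i).choose 2 := fun i => coeff_genericPoly_two (m i) (hm i)
  simp_rw [hc1, hc2] at h2
  set S1 := ∑ i : Fin n, m i with hS1
  set S2 := ∑ i : Fin n, m i * m i with hS2
  set SC := ∑ i : Fin n, (m i).choose 2 with hSC
  have e1 : ∑ i : Fin n, (m i + m i) = 2 * S1 := by
    rw [hS1, Finset.mul_sum]; exact Finset.sum_congr rfl fun i _ => by ring
  have e2 : ∑ i : Fin n, (2 * m i) ^ 2 = 4 * S2 := by
    rw [hS2, Finset.mul_sum]; exact Finset.sum_congr rfl fun i _ => by ring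
  have e3 : ∑ i : Fin n, 2 * m i = 2 * S1 := by rw [hS1, Finset.mul_sum]
  have e4 : ∑ i : Fin n, 3 * (m i).choose 2 = 3 * SC := by rw [hSC, Finset.mul_sum]
  have e5 : ∑ i : Fin n, m i * (m i + 1) = S2 + S1 := by
    rw [hS2, hS1, ← Finset.sum_add_distrib]; exact Finset.sum_congr rfl fun i _ => by ring
  have hsq : S2 = 2 * SC + S1 := by
    rw [hS2, hSC, hS1, Finset.mul_sum, ← Finset.sum_add_distrib]
    exact Finset.sum_congr rfl fun i _ => sq_eq_two_mul_choose_two_add (m i)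
  have hN : (2 * S1) * (2 * S1) = 2 * (2 * S1).choose 2 + 2 * S1 := sq_eq_two_mul_choose_two_add (2 * S1)
  rw [e2, e3, e4] at h2
  rw [e1, e5]
  nlinarith [h2, hsq, hN]

/-- **`2·dim ker(θ ↦ θ ∧ F ∣ ⋀²) = Σ_i m_i(m_i+1)` for the box of middle powers `Θ_i^{⌊m_i/2⌋}` with all `m_i ≥ 4`** (`n ≥ 1`). -/
theorem two_mul_finrank_ker_middle_box (hn : 1 ≤ n) (hm : ∀ i, 4 ≤ m i) :
    2 * finrank K (LinearMap.ker (wedge K (Gen m) 2 (hankelBox K m fun i => spikeSeq K (m i / 2)))) = ∑ i : Fin n, m i * (m i + 1) := by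
  have hrk := finrank_range_add_finrank_ker_wedge_hankelBox K m hn (fun i => spikeSeq K (m i / 2)) 2
  rw [Finset.prod_congr rfl fun i _ => hankelPoly_spike_middle K (m i)] at hrk
  have h := two_mul_choose_two_card_Gen m hm
  omega

/-- **THE KERNEL OF THE HANKEL-GENERIC BOX IS THE PRODUCT SIEGEL SPACE: `ker(θ ↦ θ ∧ F ∣ ⋀²) = SiegelBox`** for the box of middle powers with all
`m_i ≥ 4` (`n ≥ 1`; every field) — as submodules of `⋀²`, `SiegelBox` pulled back along the inclusion. -/
theorem ker_middle_box_eq_siegelBox (hn : 1 ≤ n) (hm : ∀ i, 4 ≤ m i) :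
    LinearMap.ker (wedge K (Gen m) 2 (hankelBox K m fun i => spikeSeq K (m i / 2))) =
      (siegelBox K m).comap (⋀[K]^2 (Gen m → K)).subtype := by
  symm
  apply Submodule.eq_of_le_of_finrank_eq (siegelBox_le_ker K m _)
  have h1 := two_mul_finrank_ker_middle_box K m hn hm
  have h2 := two_mul_finrank_siegelBox K m
  rw [(Submodule.comapSubtypeEquivOfLe (siegelBox_le_exteriorPower K m)).finrank_eq]
  omega

end Middle

end Summit.Ventures.HSemireg.Wedge.HankelBox
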